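import Literature.Analysis.FluidPDE.FluidComputer.ThresholdLevelTableA5
import HarnessLib

/-!
# Kernel run of the A = 5 level-table checker, chunks 40 … 43 (steps 1000 … 1099) (bp3 gen 13, layer 4)

HONEST FRAMING: low prior, high value-of-information experiment on Tao's machine paradigm; NOT a
claim that NS blows up.

Four kernel evaluations (`decide +kernel`; no `native_decide`, no extra axioms) of the checker
`runSteps` (`ThresholdLevelCheck.lean`) on 25 steps of `ThresholdLevelTableA5.stepsT` at a time, from
the entry box `Bc i` towards the next chunk's first level, returning the entry box `Bc (i+1)`
(≈ 30 s of kernel time per chunk; same scheme as `ThresholdLevelTableRun0 … 7` for A = 2).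
-/

namespace Literature.Analysis.FluidPDE.FluidComputer

namespace ThresholdLevelTableA5

set_option maxHeartbeats 10000000 in
set_option maxRecDepth 200000 in
/-- Chunk 40 of the A = 5 table run (steps 1000 … 1024). [folklore] -/
theorem run40 : runSteps 60 12 3 GIt RbIt Bc40 chunk40 7670951453562031 = some Bc41 := by
  decide +kernel

set_option maxHeartbeats 10000000 in
set_option maxRecDepth 200000 in
/-- Chunk 41 of the A = 5 table run (steps 1025 … 1049). [folklore] -/
theorem run41 : runSteps 60 12 3 GIt RbIt Bc41 chunk41 8396885449744809 = some Bc42 := by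
  decide +kernel

set_option maxHeartbeats 10000000 in
set_option maxRecDepth 200000 in
/-- Chunk 42 of the A = 5 table run (steps 1050 … 1074). [folklore] -/
theorem run42 : runSteps 60 12 3 GIt RbIt Bc42 chunk42 9191517595043004 = some Bc43 := by
  decide +kernel

set_option maxHeartbeats 10000000 in
set_option maxRecDepth 200000 in
/-- Chunk 43 of the A = 5 table run (steps 1075 … 1099). [folklore] -/
theorem run43 : runSteps 60 12 3 GIt RbIt Bc43 chunk43 10061349080634732 = some Bc44 := by
  decide +kernel

end ThresholdLevelTableA5

end Literature.Analysis.FluidPDE.FluidComputer
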